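import Summits.CriticalPhenomena.PercolationContinuityZ3.Theorems.Transplant.FKConnectivityAllQPat3VeeData2
import Summits.CriticalPhenomena.PercolationContinuityZ3.Theorems.Transplant.FKConnectivityAllQPat3VeeData3
import HarnessLib

/-!
# Connectivity correlation inequalities for `φ_{w,q}`, every `q > 0` — THE VEE\* LEAF LEMMAS of census g39 §3's 𝒦-recursion (kernel
# certificates `…Pat3VeeData1/2/3.lean` plugged into `FK.shape2C_nonneg_of_rows`; census g40)

Theorems file (`--supports stmt-CriticalPhenomena-4575`), census lineage (gen 40) of LANE 2's FK sub-programme; builds on p205010 (kernel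
theorem, internal audit signed; external expert review pending).  No named facts, no sorries; standard axioms.

SETTING: six injective names `p : Fin 6 → V` (`a b c d = p 0 … p 3`, piece marks `p 4, p 5`), the K₄-skeleton plain edges
`plainSet p FK.skelVee = {ab, ac, ad, cd}`, and two PIECE MINORS `(E₁, C₁)` in the slot `bc` (vertex set `V₁ ∋ p 4`, names inside
`V₁` only `b, c, p 4`) and `(E₂, C₂)` in the slot `bd` (`V₂ ∋ p 5`, `V₁ ∩ V₂ ⊆ {b, d}`), edge-disjoint from the skeleton and each other,
each with `famP11` levelwise nonnegative at its `(u, v, m)` (the induction hypothesis 𝒯₂(𝒦) of the recursion, in minors form).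
* `FK.skelVee_ne`, `FK.skelVee_nodup`, `FK.skelVee_marks` — the skeleton side conditions from injectivity;
* **`FK.veeStar_tsym_level_nonneg`** (`T_sym ≥ 0` levelwise at `(a, p 4, p 5)` on `(skeleton ∪ E₁ ∪ E₂, C₁ ∪ C₂)`),
  **`FK.veeStar_starA_level_nonneg`** (`STAR_x`, apex at the vertex `a`), **`FK.veeStar_starE_level_nonneg`** (`STAR_x` at `(p 4, p 5, a)`:
  apex in a slot) — census g39 §3's three VEE\* leaves («vertex w + slot e ∌ w → LEAF K4:VEE\*»).  TEMPLATE for the other leaves: the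
  EEE files' `_rows` go into `FK.shape3C_nonneg_of_rows` the same way (`Prod3.ofIdx_nonneg` with three `famGet_famP11orb_nonneg`).
[cite: AyyerLinussonRavichandran2025, §7 (p. 22)]
-/

namespace Summit.CriticalPhenomena.PercolationContinuityZ3.Theorems

namespace FK

open SimpleGraph Literature.Probability.LatticeModels Literature.Probability.Percolation
open scoped Classical

variable {V : Type*}

/-! ### THE VEE* LEAF LEMMAS (census g39 §3): the staged certificates plugged into `FK.shape2C_nonneg_of_rows` -/

section VeeLeaf

/-- Distinct names give distinct skeleton endpoints. [folklore] -/
theorem skelVee_ne {p : Fin 6 → V} (hinj : Function.Injective p) : ∀ e ∈ skelVee, p e.1 ≠ p e.2 := by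
  intro e he
  simp only [skelVee, List.mem_cons, List.mem_nil_iff, or_false] at he
  rcases he with rfl | rfl | rfl | rfl <;> exact hinj.ne (by decide)

/-- The skeleton edges are distinct as edges of `V`. [folklore] -/
theorem skelVee_nodup {p : Fin 6 → V} (hinj : Function.Injective p) : (skelVee.map (pedge p)).Nodup := by
  simp only [skelVee, List.map_cons, List.map_nil, pedge, List.nodup_cons, List.mem_cons, List.not_mem_nil,
    not_false_eq_true, List.nodup_nil, and_true, or_false, Sym2.eq, Sym2.rel_iff', Prod.mk.injEq, Prod.swap_prod_mk, hinj.eq_iff,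
    not_or, not_and]
  decide

/-- The skeleton edges avoid the two piece marks (names `4, 5`). [folklore] -/
theorem skelVee_marks {p : Fin 6 → V} (hinj : Function.Injective p) :
    ∀ e ∈ skelVee, (p e.1 ≠ p 4 ∧ p e.2 ≠ p 4) ∧ (p e.1 ≠ p 5 ∧ p e.2 ≠ p 5) := by
  intro e he
  simp only [skelVee, List.mem_cons, List.mem_nil_iff, or_false] at he
  rcases he with rfl | rfl | rfl | rfl <;> exact ⟨⟨hinj.ne (by decide), hinj.ne (by decide)⟩, ⟨hinj.ne (by decide), hinj.ne (by decide)⟩⟩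

variable [Fintype V] {p : Fin 6 → V} {E₁ C₁ E₂ C₂ : Finset (Sym2 V)} {V₁ V₂ : Set V}

/-- **LEAF VEE\* × T_sym** (census g39 §3/§4, kernel certificate `FK.veeX_tsym_rows`): on the K₄ skeleton `a b c d = p 0 … p 3` with
piece minors `(E₁, C₁)` in the slot `bc` (inner mark `p 4`) and `(E₂, C₂)` in the slot `bd` (inner mark `p 5`), each carrying `famP11`
levelwise nonnegative at its own `(u, v, m)`, the table `T_sym` is levelwise nonnegative at `(a, p 4, p 5)` on the composite minor.
[cite: AyyerLinussonRavichandran2025, §7 (p. 22)] -/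
theorem veeStar_tsym_level_nonneg (hinj : Function.Injective p)
    (hE1 : ∀ e ∈ (↑(E₁ ∪ C₁) : Set (Sym2 V)), ∀ z ∈ e, z ∈ V₁) (hE2 : ∀ e ∈ (↑(E₂ ∪ C₂) : Set (Sym2 V)), ∀ z ∈ e, z ∈ V₂)
    (hp1 : ∀ a, p a ∈ V₁ → p a = p 1 ∨ p a = p 2 ∨ p a = p 4) (hp2 : ∀ a, p a ∈ V₂ → p a = p 1 ∨ p a = p 3 ∨ p a = p 5)
    (h12 : ∀ z ∈ V₁, z ∈ V₂ → z = p 1 ∨ z = p 3) (hm1 : p 4 ∈ V₁) (hm2 : p 5 ∈ V₂)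
    (hd1 : Disjoint (plainSet p skelVee) E₁) (hd2 : Disjoint (plainSet p skelVee ∪ E₁) E₂)
    (hval1 : ∀ i ν, 0 ≤ lev2C E₁ C₁ (p 1) (p 2) (p 4) (famGet famP11 i) ν)
    (hval2 : ∀ i ν, 0 ≤ lev2C E₂ C₂ (p 1) (p 3) (p 5) (famGet famP11 i) ν) (μ : ℕ) :
    0 ≤ lev2C (plainSet p skelVee ∪ E₁ ∪ E₂) (C₁ ∪ C₂) (p 0) (p 4) (p 5) tsym2Tab μ :=
  shape2C_nonneg_of_rows hinj hE1 hE2 hp1 hp2 h12 hm1 hm2 (hinj.ne (by decide)) (hinj.ne (by decide)) rfl rfl rfl rfl rfl rfl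
    (by decide) (by decide) rfl rfl rfl (skelVee_ne hinj) (skelVee_nodup hinj) (skelVee_marks hinj) hd1 hd2 tsym2Tab (by norm_num)
    veeX_tsym_rows (Prod2.ofIdx_nonneg (famGet_famP11orb_nonneg hval1) (famGet_famP11orb_nonneg hval2)) μ

/-- **LEAF VEE\* × STAR_x, apex at the vertex `a`** (kernel certificate `FK.veeX_starX_rows`): as above, `STAR_x` is levelwise
nonnegative at `(a, p 4, p 5)` on the composite minor. [cite: AyyerLinussonRavichandran2025, §7 (p. 22)] -/
theorem veeStar_starA_level_nonneg (hinj : Function.Injective p)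
    (hE1 : ∀ e ∈ (↑(E₁ ∪ C₁) : Set (Sym2 V)), ∀ z ∈ e, z ∈ V₁) (hE2 : ∀ e ∈ (↑(E₂ ∪ C₂) : Set (Sym2 V)), ∀ z ∈ e, z ∈ V₂)
    (hp1 : ∀ a, p a ∈ V₁ → p a = p 1 ∨ p a = p 2 ∨ p a = p 4) (hp2 : ∀ a, p a ∈ V₂ → p a = p 1 ∨ p a = p 3 ∨ p a = p 5)
    (h12 : ∀ z ∈ V₁, z ∈ V₂ → z = p 1 ∨ z = p 3) (hm1 : p 4 ∈ V₁) (hm2 : p 5 ∈ V₂)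
    (hd1 : Disjoint (plainSet p skelVee) E₁) (hd2 : Disjoint (plainSet p skelVee ∪ E₁) E₂)
    (hval1 : ∀ i ν, 0 ≤ lev2C E₁ C₁ (p 1) (p 2) (p 4) (famGet famP11 i) ν)
    (hval2 : ∀ i ν, 0 ≤ lev2C E₂ C₂ (p 1) (p 3) (p 5) (famGet famP11 i) ν) (μ : ℕ) :
    0 ≤ lev2C (plainSet p skelVee ∪ E₁ ∪ E₂) (C₁ ∪ C₂) (p 0) (p 4) (p 5) starXTab μ :=
  shape2C_nonneg_of_rows hinj hE1 hE2 hp1 hp2 h12 hm1 hm2 (hinj.ne (by decide)) (hinj.ne (by decide)) rfl rfl rfl rfl rfl rfl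
    (by decide) (by decide) rfl rfl rfl (skelVee_ne hinj) (skelVee_nodup hinj) (skelVee_marks hinj) hd1 hd2 starXTab (by norm_num)
    veeX_starX_rows (Prod2.ofIdx_nonneg (famGet_famP11orb_nonneg hval1) (famGet_famP11orb_nonneg hval2)) μ

/-- **LEAF VEE\* × STAR_x, apex in a slot** (kernel certificate `FK.veeE_starX_rows`): with `x = p 4` (inner mark of the `bc` piece),
`y = p 5` (inner mark of the `bd` piece) and `s = a = p 0`, `STAR_x` is levelwise nonnegative at `(p 4, p 5, p 0)` on the composite minor.
[cite: AyyerLinussonRavichandran2025, §7 (p. 22)] -/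
theorem veeStar_starE_level_nonneg (hinj : Function.Injective p)
    (hE1 : ∀ e ∈ (↑(E₁ ∪ C₁) : Set (Sym2 V)), ∀ z ∈ e, z ∈ V₁) (hE2 : ∀ e ∈ (↑(E₂ ∪ C₂) : Set (Sym2 V)), ∀ z ∈ e, z ∈ V₂)
    (hp1 : ∀ a, p a ∈ V₁ → p a = p 1 ∨ p a = p 2 ∨ p a = p 4) (hp2 : ∀ a, p a ∈ V₂ → p a = p 1 ∨ p a = p 3 ∨ p a = p 5)
    (h12 : ∀ z ∈ V₁, z ∈ V₂ → z = p 1 ∨ z = p 3) (hm1 : p 4 ∈ V₁) (hm2 : p 5 ∈ V₂)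
    (hd1 : Disjoint (plainSet p skelVee) E₁) (hd2 : Disjoint (plainSet p skelVee ∪ E₁) E₂)
    (hval1 : ∀ i ν, 0 ≤ lev2C E₁ C₁ (p 1) (p 2) (p 4) (famGet famP11 i) ν)
    (hval2 : ∀ i ν, 0 ≤ lev2C E₂ C₂ (p 1) (p 3) (p 5) (famGet famP11 i) ν) (μ : ℕ) :
    0 ≤ lev2C (plainSet p skelVee ∪ E₁ ∪ E₂) (C₁ ∪ C₂) (p 4) (p 5) (p 0) starXTab μ :=
  shape2C_nonneg_of_rows hinj hE1 hE2 hp1 hp2 h12 hm1 hm2 (hinj.ne (by decide)) (hinj.ne (by decide)) rfl rfl rfl rfl rfl rfl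
    (by decide) (by decide) rfl rfl rfl (skelVee_ne hinj) (skelVee_nodup hinj) (skelVee_marks hinj) hd1 hd2 starXTab (by norm_num)
    veeE_starX_rows (Prod2.ofIdx_nonneg (famGet_famP11orb_nonneg hval1) (famGet_famP11orb_nonneg hval2)) μ

end VeeLeaf

end FK

end Summit.CriticalPhenomena.PercolationContinuityZ3.Theorems
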